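import Summits.CriticalPhenomena.SAWScalingLimit.Theorems.SAWDevelopingMapObservableToSLETypeLadderCarvedReductionSqueezeExits
import Summits.CriticalPhenomena.SAWScalingLimit.Theorems.SAWDevelopingMapObservableToSLETypeLadderCarvedReductionSqueezeConeFar
import HarnessLib

/-!
# The D-level envelope data of the squeeze, bundled: Schoenflies homeomorphism, mark directions,
# cone aperture, the uniform cone-separation radius, and the exits for every drift
# (piece (T-A′ P1-data) of stub T-A′ `stub_carvedReduction_squeezeGeometry_domains`)

Crux `SAWDevelopingMap.ObservableToSLE` (stmt-CriticalPhenomena-10472), line `six-class-type-ladder`,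
stub T-A′ `stub_carvedReduction_squeezeGeometry_domains`.  Landing target:
`Summits/CriticalPhenomena/SAWScalingLimit/Theorems/SAWDevelopingMapObservableToSLETypeLadderCarvedReductionSqueezeEnvelopeData.lean`
(`--supports stmt-CriticalPhenomena-10472`; registered carrier `stub_carvedReduction_envelopeData`).
`stub_carvedReduction_exits` (p144216) and `stub_carvedReduction_coneFar` (p145078) for the SAME
`(H, d, β)`: the lead calls this once, right after `D`, and puts `ε/2` into the locality scale
`R₀` (worker log, E0); the assembly of the super-domain then receives `(H, d, β, ε)` with exactly
these facts.
-/

noncomputable section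
open scoped Topology ComplexConjugate
open Filter Set Metric Function
open Literature.Probability.RandomPlanarGeometry
open Literature.Topology.PlaneTopology

namespace Summit.CriticalPhenomena.SAWScalingLimit.Theorems.ObservableToSLE.TypeLadder

/-- **Registered carrier `stub_carvedReduction_envelopeData`** (crux item stmt-CriticalPhenomena-10472,
stub T-A′ `stub_carvedReduction_squeezeGeometry_domains`, piece THE D-LEVEL ENVELOPE DATA):
`stub_carvedReduction_exits` and `stub_carvedReduction_coneFar` for the same `(H, d, β)`. -/
theorem stub_carvedReduction_envelopeData :
    ∀ (D : DobrushinDomain), ∃ (H : ℂ ≃ₜ ℂ) (d : Fin 2 → ℂ) (β ε : ℝ),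
      0 < β ∧ β < 1 ∧ 0 < ε ∧ (∀ i, ‖d i‖ = 1) ∧ d 0 ≠ d 1 ∧ (∀ i, H (d i) = D.pt i) ∧
      H '' ball 0 1 = D.carrier ∧ H '' closedBall 0 1 = closure D.carrier ∧
      (∀ (τ : ℂ) (i k : Fin 2), i ≠ k →
        Disjoint ((H.trans (Homeomorph.addRight (-τ))) ''
            {w : ℂ | 1 ≤ (w * conj (d k)).re ∧ (1 - β) * ‖w‖ ≤ (w * conj (d k)).re})
          (ball (H (d i) - τ) ε)) ∧
      ∀ (τ : ℂ) (ϱ₀ ζ : ℝ), 0 < ζ →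
        ∃ (r₁ r₂ : ℝ) (J : JordanDomain) (η : Fin 2 → Set ℂ) (x : Fin 2 → Fin 2 → ℂ) (F : Fin 2 → Set ℂ),
          1 < r₁ ∧ r₁ < r₂ ∧
          J.carrier = (H.trans (Homeomorph.addRight (-τ))) '' ball 0 r₂ ∧
          frontier J.carrier = (H.trans (Homeomorph.addRight (-τ))) '' sphere 0 r₂ ∧
          closure ((fun z => z - τ) '' D.carrier) = (H.trans (Homeomorph.addRight (-τ))) '' closedBall 0 1 ∧
          closure ((fun z => z - τ) '' D.carrier) ⊆ J.carrier ∧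
          (∀ i, closedBall (D.pt i - τ) ϱ₀ ⊆ J.carrier) ∧
          (∀ i, J.IsCrosscut (η i) (x i 0) (x i 1)) ∧ (∀ i, η i \ {x i 0, x i 1} ⊆ F i) ∧
          (∀ i, IsOpen (F i)) ∧ (∀ i, IsConnected (F i)) ∧ (∀ i, F i ⊆ J.carrier) ∧
          (∀ i, Disjoint (closure (F i)) ((H.trans (Homeomorph.addRight (-τ))) '' closedBall 0 1)) ∧
          (∀ i, F i ⊆ (H.trans (Homeomorph.addRight (-τ))) ''
            {w : ℂ | 1 ≤ (w * conj (d i)).re ∧ (1 - β) * ‖w‖ < (w * conj (d i)).re}) ∧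
          Disjoint (F 0 ∪ {x 0 0, x 0 1}) (F 1 ∪ {x 1 0, x 1 1}) ∧
          (∀ i, ∃ z ∈ F i, dist z (D.pt i - τ) < ζ) ∧
          (∀ i k, x i k ∈ frontier J.carrier) := by
  intro D
  obtain ⟨H, d, β, hβ0, hβ1, hdn, hd01, hHd, hball, hcl, -, hexits⟩ := stub_carvedReduction_exits D
  obtain ⟨ε, hε, hfar⟩ := stub_carvedReduction_coneFar H d β hdn hd01 hβ0
  exact ⟨H, d, β, ε, hβ0, hβ1, hε, hdn, hd01, hHd, hball, hcl, hfar, hexits⟩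

end Summit.CriticalPhenomena.SAWScalingLimit.Theorems.ObservableToSLE.TypeLadder

end
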